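import Summits.KontsevichZagierPeriods.KontsevichZagierPeriods.Theses.Grothendieck
import Summits.KontsevichZagierPeriods.KontsevichZagierPeriods.Theorems.GrothendieckGpcLegendreLemniscatic
import Summits.KontsevichZagierPeriods.KontsevichZagierPeriods.Theorems.GrothendieckGpcZeta4Eq4zeta31
import Summits.KontsevichZagierPeriods.KontsevichZagierPeriods.Theorems.GrothendieckKEAlgIndependent
import Summits.KontsevichZagierPeriods.KontsevichZagierPeriods.Theorems.GrothendieckLemniscaticSectorGlue
import Summits.KontsevichZagierPeriods.KontsevichZagierPeriods.Theorems.ReducedPeriodRing.Negative.PositiveCone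
import Summits.KontsevichZagierPeriods.KontsevichZagierPeriods.Theorems.LowDimensionLowdimBaker0DimLeOne
import Summits.KontsevichZagierPeriods.KontsevichZagierPeriods.Theorems.UnfoldedStokesStokesGenerationLineReduction
import Summits.KontsevichZagierPeriods.KontsevichZagierPeriods.Theorems.TypeAGenerationConjecture
import Literature.NumberTheory.Transcendental.KZKernelConjectureForms
import Literature.NumberTheory.Transcendental.KZRulesAssociator
import Mathlib.Algebra.FreeAbelianGroup.Finsupp

/-!
# Strategist sketch, seat p1 (wall-breaker pass) — crux stmt-KontsevichZagierPeriods-11102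
# `Grothendieck.SectorComplement`

Typed, kernel-checked companion of `STRATEGY-CENSUS.md` (planner, crux-strategist mode, gen 1,
wall-breaker seat p1, 2026-08-17). Nothing here is a line or a stub; the file records what each
lens produced THIS pass, as theorems, so the census can point at them.

* §0 `sectorComplement_iff_summit : SectorComplement ↔ KontsevichZagierPeriods` — UNCONDITIONAL
  now: the route's rank-5 crux 0280 `GpcLegendreLemniscatic` closed 2026-08-16T16:39Z
  (`GpcLegendreLemniscaticLine.GpcLegendreLemniscatic_proof`), and 8611/8612/0275 were already
  tree theorems. The crux is literally the summit (Kontsevich–Zagier 2001, §1.2, Conjecture 1 over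
  the calculus of `KZCalculus.lean`).
* §1 ORDER SPLIT (lens transfer/strengthen: the inequality companion of Conjecture 1). With the
  positive cone `C ⊆ FormalRep` (sums of representations with non-negative integrands; landed
  tools `ReducedPeriodRingNegative.*`): `KontsevichZagierPeriods ⇐ ArchCertificates ∧ NoInfinitesimals`
  (`summit_of_arch_of_noInf`), `NoInfinitesimals ⇐ summit` (`noInf_of_summit`), and the death
  certificate `noInf_iff_summit_of_arch : ArchCertificates → (NoInfinitesimals ↔ summit)`.
  `ArchCertificates` ("every strict inequality between periods has a move certificate") is route
  InequalityCost's provable layer (Viu-Sos packing); the remainder is again the summit.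
* §2 LADDER FORM (lens strengthen-to-induct): with `Layer d` = Conjecture 1 for pairs of
  dimensions `≤ d`, `Layer 1` is a TREE THEOREM (10622, Baker engine, closed 2026-08-16T20:42Z),
  `summit ↔ ∀ d, Layer d`, and the inductive step `LadderStep` is PROVED equivalent to the summit
  (`ladderStep_iff_summit`) — no heredity is gained by indexing on dimension.
* §3 RATIONAL INTERMEDIATES (lens strengthen): `RationalChains` (chains through KZ-rational
  representations only) is typed and `summit_of_rationalChains` proved; the converse is not claimed.
* §4 D1 IS BUILT ELSEWHERE (lens decomposition): the Ayoub cube bridge glue is a theorem of route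
  UnfoldedStokes (`StokesGenerationLine.kontsevichZagierPeriods_of_typeA_of_cubeNashNormalForm`);
  here `d1_glue : CubeNashNormalForm → TypeAGenerationConjecture → SectorComplement` and
  `d1_remainder_of_summit`-type read-backs record that its pieces are LiftingCriteria's 3574 (open,
  a genuine theorem-in-progress) and the conjecture leaf `TypeAGenerationConjecture` (Ayoub 2015
  Conj. 1.1), i.e. the split already served on crux 3586.
-/

noncomputable section

set_option linter.dupNamespace false

namespace Summit.KontsevichZagierPeriods.KontsevichZagierPeriods.Cruxes.SectorComplement.StrategistP1

open Set MeasureTheory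
open Literature.NumberTheory.Transcendental
open Literature.NumberTheory.Transcendental.KZ
open Summit.KontsevichZagierPeriods.KontsevichZagierPeriods.Theses.Grothendieck
open Summit.KontsevichZagierPeriods.Grothendieck (gpcZeta4Eq4zeta31_proof keAlgIndependent_proof)
open Summit.KontsevichZagierPeriods.Grothendieck.LemniscaticSectorGlue (lemniscaticSectorGlue_proof)
open Summit.KontsevichZagierPeriods.Grothendieck.GpcLegendreLemniscaticLine (GpcLegendreLemniscatic_proof)
open Summit.KontsevichZagierPeriods.KontsevichZagierPeriods.ReducedPeriodRingNegative
  (of_mem_cone eval_nonneg_of_mem_cone mem_relations_of_mem_cone_of_eval_eq_zero exists_cone_sub_cone)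

/-! ## §0 Read-back 2026-08-17: the crux is the summit, unconditionally -/

/-- The summit IS the kernel form (tree theorem `kzKernelConjecture_iff_isRational`). [folklore] -/
theorem summit_iff_kernel : KontsevichZagierPeriods ↔ KZKernelConjecture :=
  kzKernelConjecture_iff_isRational.symm

/-- `H₂` (0275) is a tree theorem. [folklore] -/
theorem h2_holds : GpcZeta4Eq4zeta31 := gpcZeta4Eq4zeta31_proof

/-- 0280 (Legendre's relation at `k² = 1/2` inside the calculus) is a tree theorem since
2026-08-16T16:39Z. [folklore] -/
theorem legendre_holds : GpcLegendreLemniscatic := GpcLegendreLemniscatic_proof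

/-- Hence `H₁` (8598, the lemniscatic sector kernel) is a tree theorem (8611 + 8612 + 0280). [folklore] -/
theorem h1_holds : LemniscaticSectorKernel :=
  lemniscaticSectorGlue_proof keAlgIndependent_proof legendre_holds

/-- **THE CRUX TODAY (2026-08-17): `SectorComplement ↔ KontsevichZagierPeriods`, unconditionally.**
Both antecedents of the crux are tree theorems, so the item is Conjecture 1 of Kontsevich–Zagier
(2001, §1.2) for all pairs, verbatim the summit. [cite: KontsevichZagier2001, §1.2 Conjecture 1] -/
theorem sectorComplement_iff_summit : SectorComplement ↔ KontsevichZagierPeriods :=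
  ⟨fun h => h h1_holds h2_holds, fun h _ _ => h⟩

/-- … and in kernel form. [folklore] -/
theorem sectorComplement_iff_kernel : SectorComplement ↔ KZKernelConjecture :=
  sectorComplement_iff_summit.trans summit_iff_kernel

/-- The negative reading: refuting the crux is refuting the summit, and conversely. [folklore] -/
theorem not_sectorComplement_iff : ¬ SectorComplement ↔ ¬ KontsevichZagierPeriods :=
  not_congr sectorComplement_iff_summit

/-! ## §1 Order split: Conjecture 1 = (inequality certificates) ∧ (no infinitesimals)

The positive cone `C` is written out as in the landed `ReducedPeriodRing/Negative/PositiveCone.lean`: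
`AddSubmonoid.closure (FreeAbelianGroup.of '' {x | ∀ y ∈ x.2.domain, 0 ≤ x.2.integrand y})`. -/

/-- **The positive cone** `C = ℕ[non-negative representations] ⊆ FormalRep`. -/
abbrev posCone : AddSubmonoid FormalRep :=
  AddSubmonoid.closure (FreeAbelianGroup.of ''
    {x : Σ n, IntegralRep n | ∀ y ∈ x.2.domain, 0 ≤ x.2.integrand y})

/-- `c ≼ d`: `d − c` is a cone element modulo relations (the preorder of `P = FormalRep ⧸ relations`
induced by `C`). -/
def ConeLE (c d : FormalRep) : Prop := ∃ u ∈ posCone, d - c - u ∈ relations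

/-- **ARCH — inequality certificates.** Every formal combination of strictly positive value is
move-equivalent to a sum of representations with non-negative integrands ("every true strict
inequality between periods has a certificate inside the rules"). This is the provable layer of route
InequalityCost (Viu-Sos' packing lemmas run inside the rules; arXiv:1509.01097 §4), NOT claimed here. -/
def ArchCertificates : Prop := ∀ c : FormalRep, 0 < eval c → ∃ u ∈ posCone, c - u ∈ relations

/-- `c` is INFINITESIMAL for the cone preorder with order unit `[pt, 1]`:
`n • c ≼ 1` and `−(n • c) ≼ 1` for every `n`. -/
def Infinitesimal (c : FormalRep) : Prop :=
  ∀ n : ℕ, ConeLE (n • c) (of IntegralRep.unit) ∧ ConeLE (-(n • c)) (of IntegralRep.unit)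

/-- **NOINF — no infinitesimals.** The preordered group `(P, C, 1)` is Archimedean in the sense that
its only infinitesimal is `0`. -/
def NoInfinitesimals : Prop := ∀ c : FormalRep, Infinitesimal c → c ∈ relations

/-- **POSREP** — every formal combination of positive value has the value of ONE representation with
non-negative integrand (provable: sign split + packing; InequalityCost / ScissorsTransport territory;
not attempted here). -/
def PosRep : Prop :=
  ∀ c : FormalRep, 0 < eval c → ∃ (n : ℕ) (r : IntegralRep n),
    (∀ y ∈ r.domain, 0 ≤ r.integrand y) ∧ r.value = eval c

/-- `≼` is sound for values. [folklore] -/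
theorem eval_le_of_coneLE {c d : FormalRep} (h : ConeLE c d) : eval c ≤ eval d := by
  obtain ⟨u, hu, hrel⟩ := h
  have h0 : eval (d - c - u) = 0 := relations_le_ker_eval_holds hrel
  rw [map_sub, map_sub] at h0
  have := eval_nonneg_of_mem_cone hu
  linarith

/-- **The cone is pointed modulo relations** (ANTI): if a sum of two cone elements is a relation,
both are (values: two non-negative numbers summing to `0`; then the landed
`mem_relations_of_mem_cone_of_eval_eq_zero`). So `(P, C)` is a genuine partially ordered group. [folklore] -/
theorem cone_pointed {u v : FormalRep} (hu : u ∈ posCone) (hv : v ∈ posCone)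
    (h : u + v ∈ relations) : u ∈ relations ∧ v ∈ relations := by
  have h0 : eval (u + v) = 0 := relations_le_ker_eval_holds h
  rw [map_add] at h0
  have hu0 := eval_nonneg_of_mem_cone hu
  have hv0 := eval_nonneg_of_mem_cone hv
  exact ⟨mem_relations_of_mem_cone_of_eval_eq_zero hu (by linarith),
    mem_relations_of_mem_cone_of_eval_eq_zero hv (by linarith)⟩

/-- An infinitesimal has value `0` (soundness + the Archimedean property of `ℝ`). [folklore] -/
theorem eval_eq_zero_of_infinitesimal {c : FormalRep} (h : Infinitesimal c) : eval c = 0 := by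
  by_contra hne
  obtain ⟨n, hn⟩ := exists_nat_gt (1 / |eval c|)
  have hpos : 0 < |eval c| := abs_pos.mpr hne
  have h1 : (1 : ℝ) < n * |eval c| := by
    have := (div_lt_iff₀ hpos).mp hn
    linarith
  obtain ⟨hle, hle'⟩ := h n
  have e1 := eval_le_of_coneLE hle
  have e2 := eval_le_of_coneLE hle'
  simp only [map_nsmul, map_neg, nsmul_eq_mul, eval_of, IntegralRep.value_unit] at e1 e2
  have : (n : ℝ) * |eval c| ≤ 1 := by
    rcases le_or_gt 0 (eval c) with hc | hc
    · rw [abs_of_nonneg hc]; exact e1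
    · rw [abs_of_neg hc]; linarith
  linarith

/-- Under ARCH, every value-zero class is infinitesimal: `1 ∓ n•c` has value `1 > 0`, hence is a
cone element modulo relations. [folklore] -/
theorem infinitesimal_of_eval_eq_zero (hA : ArchCertificates) {c : FormalRep} (hc : eval c = 0) :
    Infinitesimal c := by
  intro n
  constructor
  · obtain ⟨u, hu, hrel⟩ := hA (of IntegralRep.unit - n • c) (by simp [hc])
    exact ⟨u, hu, hrel⟩
  · obtain ⟨u, hu, hrel⟩ := hA (of IntegralRep.unit - -(n • c)) (by simp [hc])
    exact ⟨u, hu, hrel⟩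

/-- **ARCH ∧ NOINF ⇒ the summit.** [cite: KontsevichZagier2001, §1.2 Conjecture 1] -/
theorem summit_of_arch_of_noInf (hA : ArchCertificates) (hN : NoInfinitesimals) :
    KontsevichZagierPeriods :=
  summit_iff_kernel.mpr fun c hc => hN c (infinitesimal_of_eval_eq_zero hA hc)

/-- **Summit ⇒ NOINF** (an infinitesimal has value `0`). [folklore] -/
theorem noInf_of_summit (h : KontsevichZagierPeriods) : NoInfinitesimals :=
  fun c hc => summit_iff_kernel.mp h c (eval_eq_zero_of_infinitesimal hc)

/-- Summit ∧ POSREP ⇒ ARCH (so, granted the provable POSREP, the split is tight). [folklore] -/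
theorem arch_of_summit_of_posRep (h : KontsevichZagierPeriods) (hP : PosRep) : ArchCertificates := by
  intro c hc
  obtain ⟨n, r, hr, hv⟩ := hP c hc
  refine ⟨of r, of_mem_cone r hr, summit_iff_kernel.mp h _ ?_⟩
  rw [map_sub, eval_of, hv, sub_self]

/-- **DEATH CERTIFICATE of the order split**: given its buildable layer ARCH, the remainder NOINF is
the summit on the nose. [folklore] -/
theorem noInf_iff_summit_of_arch (hA : ArchCertificates) : NoInfinitesimals ↔ KontsevichZagierPeriods :=
  ⟨summit_of_arch_of_noInf hA, noInf_of_summit⟩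

/-- … and therefore the crux, too. [folklore] -/
theorem noInf_iff_crux_of_arch (hA : ArchCertificates) : NoInfinitesimals ↔ SectorComplement :=
  (noInf_iff_summit_of_arch hA).trans sectorComplement_iff_summit.symm

/-- Every formal combination is squeezed between cone elements: `c ≡ P − Q`, `P, Q ∈ C` (landed
`exists_cone_sub_cone`), so `(P, C)` is DIRECTED and `[pt,1]`-bounded classes exhaust nothing new;
recorded as the structural input a Goodearl–Handelman state-space argument would start from. [folklore] -/
theorem directed (c : FormalRep) : ∃ P Q : FormalRep, P ∈ posCone ∧ Q ∈ posCone ∧ c - (P - Q) ∈ relations :=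
  exists_cone_sub_cone c

/-! ## §2 Ladder form: indexing Conjecture 1 by dimension gains no heredity -/

/-- `Layer d`: Conjecture 1 for pairs of KZ-rational representations of dimensions `≤ d`. -/
def Layer (d : ℕ) : Prop :=
  ∀ ⦃n m : ℕ⦄, n ≤ d → m ≤ d → ∀ (r : IntegralRep n) (r' : IntegralRep m),
    r.IsRational → r'.IsRational → r.value = r'.value → Equivalent r r'

/-- **`Layer 1` is a tree theorem** (item 10622 `LowdimBaker0DimLeOne`, closed 2026-08-16: Conjecture 1
for all pairs of dimensions `≤ 1`, engine Baker's theorem). [cite: KontsevichZagier2001, §1.2 Conjecture 1] -/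
theorem layer_one : Layer 1 := fun _ _ hn hm r r' hr hr' hv =>
  Summit.KontsevichZagierPeriods.LowDimension.LowdimBaker0DimLeOne.lowdimBaker0DimLeOne_proof hn hm r r' hr hr' hv

/-- Layers are monotone. [folklore] -/
theorem layer_mono {d e : ℕ} (hde : d ≤ e) (h : Layer e) : Layer d :=
  fun _ _ hn hm r r' hr hr' hv => h (hn.trans hde) (hm.trans hde) r r' hr hr' hv

/-- The summit is the conjunction of all layers. [folklore] -/
theorem summit_iff_forall_layer : KontsevichZagierPeriods ↔ ∀ d, Layer d := by
  constructor
  · intro h d n m _ _ r r' hr hr' hv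
    exact KontsevichZagierPeriods_iff.mp h r r' hr hr' hv
  · intro h
    exact KontsevichZagierPeriods_iff.mpr fun n m r r' hr hr' hv =>
      h (max n m) (le_max_left n m) (le_max_right n m) r r' hr hr' hv

/-- **The inductive step** `Layer d → Layer (d+1)` for all `d ≥ 1` (the strengthen-to-induct form). -/
def LadderStep : Prop := ∀ d : ℕ, 1 ≤ d → Layer d → Layer (d + 1)

/-- LadderStep ⇒ summit, by induction from the landed `Layer 1`. [folklore] -/
theorem summit_of_ladderStep (h : LadderStep) : KontsevichZagierPeriods := by
  have key : ∀ d, Layer (d + 1) := by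
    intro d
    induction d with
    | zero => exact layer_one
    | succ d ih => exact h (d + 1) (Nat.le_add_left 1 d) ih
  exact summit_iff_forall_layer.mpr fun d => layer_mono (Nat.le_succ d) (key d)

/-- **DEATH CERTIFICATE of the ladder**: the inductive step IS the summit (given the landed base),
because every pair of dimension `d+1` whose value is a new period makes the hypothesis `Layer d` idle;
no hereditary mechanism exists (GenericPointClass's trace no-go). [folklore] -/
theorem ladderStep_iff_summit : LadderStep ↔ KontsevichZagierPeriods :=
  ⟨summit_of_ladderStep, fun h d _ _ => (summit_iff_forall_layer.mp h) (d + 1)⟩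

/-! ## §3 Rational intermediates (Kontsevich–Zagier's own question after Conjecture 1) -/

/-- A formal combination is supported on KZ-RATIONAL representations. -/
def IsRatSupported (c : FormalRep) : Prop :=
  ∀ x ∈ FreeAbelianGroup.support c, x.2.IsRational

/-- Move instances all of whose representations are KZ-rational. -/
def ratMoves : Set FormalRep :=
  (domainAddRel ∪ integrandAddRel ∪ changeOfVariablesRel ∪ newtonLeibnizRel) ∩ {c | IsRatSupported c}

/-- The subgroup generated by rational move instances. -/
def relationsRat : AddSubgroup FormalRep := AddSubgroup.closure ratMoves

/-- **S⁺ (rational intermediates)**: every value-zero combination of rational representations is a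
`ℤ`-combination of move instances among RATIONAL representations only. -/
def RationalChains : Prop := ∀ c : FormalRep, IsRatSupported c → eval c = 0 → c ∈ relationsRat

/-- Rational chains are chains. [folklore] -/
theorem relationsRat_le : relationsRat ≤ relations :=
  AddSubgroup.closure_mono Set.inter_subset_left

/-- `[r] − [r']` is supported on `{r, r'}`. [folklore] -/
theorem isRatSupported_of_sub_of {n m : ℕ} {r : IntegralRep n} {r' : IntegralRep m}
    (hr : r.IsRational) (hr' : r'.IsRational) : IsRatSupported (of r - of r') := by
  classical
  intro x hx
  rw [sub_eq_add_neg] at hx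
  have hx' := FreeAbelianGroup.support_add _ _ hx
  rw [FreeAbelianGroup.support_neg] at hx'
  simp only [of, FreeAbelianGroup.support_of, Finset.mem_union, Finset.mem_singleton] at hx'
  rcases hx' with rfl | rfl
  · exact hr
  · exact hr'

/-- **S⁺ ⇒ summit** (the strengthening is at least the summit). The converse — simulating every move
between algebraic representations by moves between rational ones via the graph trick — is expected
but not attempted (it would make S⁺ ≡ summit and buy no rigidity). [cite: KontsevichZagier2001, §1.2] -/
theorem summit_of_rationalChains (h : RationalChains) : KontsevichZagierPeriods :=
  KontsevichZagierPeriods_iff.mpr fun n m r r' hr hr' hv =>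
    relationsRat_le (h _ (isRatSupported_of_sub_of hr hr') (by rw [map_sub, eval_of, eval_of, hv, sub_self]))

/-! ## §4 D1 (Ayoub cube bridge) is built on route UnfoldedStokes; its remainder is the conjecture leaf -/

open Summit.KontsevichZagierPeriods.KontsevichZagierPeriods.Theses.LiftingCriteria (CubeNashNormalForm)
open Summit.KontsevichZagierPeriods.KontsevichZagierPeriods.StokesGenerationLine
  (kontsevichZagierPeriods_of_typeA_of_cubeNashNormalForm)

/-- **D1 glue, for THIS crux**: LiftingCriteria's open support item `CubeNashNormalForm` (3574; the
cube–Nash normal form inside the moves, embedded resolution over `ℝ` its open part) and Ayoub's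
Conjecture 1.1 (`TypeAGenerationConjecture`, conjecture leaf) imply `SectorComplement` — via the
LANDED line reduction of crux 3586 (route UnfoldedStokes) and §0. The split is served THERE; it is
recorded here so the census can say exactly which piece carries the summit (`TypeAGenerationConjecture`).
[cite: Ayoub2015, Conj. 1.1] -/
theorem d1_glue (hN : CubeNashNormalForm) (hT : TypeAGenerationConjecture) : SectorComplement :=
  sectorComplement_iff_summit.mpr
    (kontsevichZagierPeriods_of_typeA_of_cubeNashNormalForm
      (hT (algebraicClosure ℚ ℂ) (algebraMap (algebraicClosure ℚ ℂ) ℂ) fun c =>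
        (mem_algebraicClosure_iff.1 c.2 : IsAlgebraic ℚ (algebraMap (algebraicClosure ℚ ℂ) ℂ c)))
      hN)

/-- Read-back: given 3574, Ayoub's conjecture already decides the summit (so on this crux the D1
remainder is `TypeAGenerationConjecture`, a published conjecture of Grothendieck-period-conjecture
strength — renamed, not lowered). [cite: Ayoub2015, Conj. 1.1] -/
theorem summit_of_typeA_of_cubeNash (hN : CubeNashNormalForm) (hT : TypeAGenerationConjecture) :
    KontsevichZagierPeriods :=
  sectorComplement_iff_summit.mp (d1_glue hN hT)

end Summit.KontsevichZagierPeriods.KontsevichZagierPeriods.Cruxes.SectorComplement.StrategistP1
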